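import Literature.MathematicalPhysics.QuantumFieldTheory.Balaban1983to89.Node00.CarriersB8SubBPCutP
import Literature.MathematicalPhysics.QuantumFieldTheory.Balaban1983to89.B8Prop6PrintedZdCubPGamma

/-!
# `Balaban1983to89.B8LeafOfRecordSubBPCutPFields8` — THE N05 P-SLOT `Node00.B8LeafOfRecordSubBP` AT THE PRINT-CLASS CUT LAYER `λ.cutSubBP J lan c₁ ρ₀`:
# its conjunct-by-conjunct reading, FULL cut ⇒ PRINT-CLASS cut, and ★★★ the slot's CONSTRUCTOR FROM EIGHT BINDERS — [Balaban1985RegularSpaces] PROPOSITION 6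
# (p. 99) SUPPLIED by the unconditional family-level theorem on print's p. 98 cube class (`θ.D ≥ 2`, `θ.L ≥ 5`)

statement-level skeleton of published theorems with citation tags; proofs where landed; nothing here is a claim about the
Yang–Mills mass gap

PDF held: `paper:balaban1985-cmp99-regular-spaces-gauge-fixing`; Prop. 6 p. 99 ((1.135)–(1.138)), p. 98 (the cubes of Prop. 6), Lemma 1 p. 79, Thm 2 p. 83, Prop. 3
p. 87, Thm 4 p. 88, Prop. 5 p. 94, Prop. 7 p. 100, Thm 8 (1.146) p. 101 (the eight displayed binders).

CITATION HEADER (lean-in-tree rule).  Cell `pub-ymgap` (HUMAN RULING D-0062, Track A), DAG node N05 = [B8], seat `pub-ymgap-dag-n05-e` g11 (R141 (C) row s3b —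
Proposition 6's cube road).  WHY THIS FILE.  The knits of record (dag-n05-d D9b p596490 `b8LeafOfRecordSubBP_cutSubB_of_knit_lettersSrc_γ'`, D9c) conclude n05-w1's
re-pinned slot at dag-n05-d's cut layer `λ.cutSubB J lan c₁`, whose Proposition-6 members are ALL `CubeB8` cubes (`cubB8OfRecord θ ·.1 = zdCub`), so `p6` stays
DISPLAYED there (no print-faithful supplier serves the full class — LOCATED-CARRIER).  At the print-class cut layer `λ.cutSubBP J lan c₁ ρ₀` (this seat's
`Node00/CarriersB8SubBPCutP`: `cub := fun j => zdCubP θ.𝔸 θ.L ρ₀ j.1.1`) Proposition 6's conjunct IS the landed family-level theorem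
`B8Prop6PrintedZdCubPGamma.p6_residB8_of_zdCubP` (p596570; Fγ11 ∘ general junction; unconditional for `θ.D ≥ 2`, odd `θ.L ≥ 5`).  THIS FILE: §1 the reading of the slot
at the print-class cut conjunct by conjunct (n05-w1's `b8LeafOfRecordSubBP_iff_classFree_and_P` there), ★ FULL cut ⇒ PRINT-CLASS cut at every `ρ₀` (nothing the
knits of record conclude is lost by the re-key) and ★ the transfer WITH THRESHOLD CHANGE `…_of_cutSubB'`; §1b the LOCATED HAZARD certificate (k0-s2-w2 g3 OFFER-C §3,
folded here on their word): the typed Proposition-6 conjunct is VACUOUSLY TRUE at any threshold `c₁ ≤ 0` (`prop6Printed_zdCub_of_nonpos`, `…_zdCubP_of_nonpos`,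
`prop6Printed_cubB8OfRecord_subB_of_nonpos`) — so the knits of record BY NAME at `c₁ := 0` need no Proposition-6 input; §2 ★★★ `b8LeafOfRecordSubBP_cutSubBP_of_fields8`
— the slot's constructor at the print-class cut from the EIGHT binders `l1 t2 p3 t4 p5e p5u p7 t8` (letter for letter n05-w1's `b8LeafOfRecordSubBP_of_fields` binders at
that layer) — `p6` is no longer a binder; `…_dvd` (WLOG `t ∣ ρ₀`); ★★★ `b8LeafOfRecordSubBP_cutSubBP_of_cutSubB_any` — THE BY-NAME ROAD (k0-s2-w2 g3's threshold-zero
device): the slot at dag-n05-d's cut with ANY source threshold (e.g. `0`, Prop-6-free) ⇒ the slot at the print-class cut at the GENUINE threshold `c₁⋆ > 0`, one dial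
`B₁⋆ ≤ λ.B₁`; §3 non-vacuity of the layer's Proposition-6 index.  Kind «kernel-checked proof»; theorems only, no `def`.

HONEST SCOPE ∕ A6.  By-name bookkeeping + ONE application of p596570; the analytic content of `p6` is dag-n05-c's transplant T4 + this seat's flat line γ (Fγ1–Fγ11),
in the tree with standard axioms and read (ref-E READ-12 ∕ READ-33 ∕ Fγ11 watch).  The EIGHT remaining binders are DISPLAYED hypotheses — Lemma 1 (kernel instance
exists: `lemma1Printed_blockPairNA`), Thm 2 ∕ Prop 3 ∕ Thm 4 ∕ Thm 8 at the P-members (the γ′ D-chain, modulo [Balaban1985BackgroundPropagators]-type sockets = N06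
content), Prop. 5 ∃ ∕ ! at `lan` (D9c at `zdLan`), Prop. 7 (n05-w1 ∕ n05-w2's collar instance) — NOT claimed here.  The two dials `B₁⋆ ≤ λ.B₁`, `c₁ ≤ c₁⋆` are
print's «there exist constants B₁, …, c₁» (Thm 2 p. 83): the knit takes `B₁` large (layer equation `λ.B₁ = 5dL·B₈(1+11d²)`, `B₈` free from below) and `c₁` small.
Which cut the record's ∃-currency names is NODE 00's ∕ the planners' ∕ dag-n05-d's call.  N05 NOT discharged by this file; count-neutral until a referee's act-(iv)
read and the chair's word; one finite `𝕋⁴` programme at fixed `ε`, Bałaban as printed; nothing continuum ∕ ℝ⁴ ∕ OS ∕ mass-gap ∕ Clay.  No `sorry`, no `def`, no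
`instance`, no `notation`; standard axioms.  Unit `pub-ymgap-dag-n05-e` (g11), 2026-08-28.
-/

noncomputable section

namespace Literature.MathematicalPhysics.QuantumFieldTheory.Balaban1983to89.B8LeafOfRecordSubBPCutPFields8

open DagBinding
open B8LeafKnitRS (B8LeafRS)
open B8LeafModelZd (ZdIdx)
open B8LeafModelZd3P (zdGF3P zdGF3HP)
open B8Lemma1NonAbelian (blockPairNA)
open B8IdxB8LawsB (IdxB8LawsB IdxB8SubB)
open B8Prop6PrintedZdCubPGamma (p6_residB8_of_zdCubP)
open Node00 (Stage3Params ResidB8 zdCubP cubB8OfRecord famB8OfRecordSubBP B8LeafOfRecordSubBP b8LeafOfRecordSubBP_iff_classFree_and_P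
  b8LeafOfRecordSubBP_cutSubB_iff_classFree_and_P prop6Printed_zdCubP_of_zdCub)

/-! ## §1  The reading of the P-slot at the print-class cut layer; FULL cut ⇒ PRINT-CLASS cut -/

section ReadingP

variable {θ : Stage3Params}

/-- **THE P-SLOT AT THE PRINT-CLASS CUT LAYER, READ CONJUNCT BY CONJUNCT** (n05-w1's `b8LeafOfRecordSubBP_iff_classFree_and_P` at `λ.cutSubBP J lan c₁ ρ₀`): the
four class-free conjuncts — Lemma 1, Prop. 5 ∃ ∕ ! at `lan`, PROPOSITION 6 ON PRINT'S CLASS `B8.Prop6Printed θ.D θ.L λ.B₁ c₁ (fun j => zdCubP θ.𝔸 θ.L ρ₀ j.1.1)` — ∧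
Thm 2 ∕ Prop 3 ∕ Thm 4 ∕ Prop 7 ∕ Thm 8 surviving at γ = 1 at the P-members with `λ.B₁', λ.C₂, λ.B₁, λ.B₂`.
[cite: Balaban1985RegularSpaces, Lemma 1 p.79, Thm 2 p.83, Prop. 3 p.87, Thm 4 p.88, Prop. 5 p.94, Prop. 6 p.99, Prop. 7 p.100, Thm 8 (1.146) p.101] -/
theorem b8LeafOfRecordSubBP_cutSubBP_iff_classFree_and_P (lam : ResidB8 θ) (J : Type) (lan : J → B8.LandauData) (c₁ : ℝ) (ρ₀ : ℕ) :
    B8LeafOfRecordSubBP θ (lam.cutSubBP J lan c₁ ρ₀) ↔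
      (B8.Lemma1Printed θ.D (blockPairNA θ.D θ.L θ.𝔸) ∧
        B8.Prop5Exists lam.inp.B₀' lam.B₁ lan ∧ B8.Prop5Unique lan ∧
        B8.Prop6Printed θ.D (θ.L : ℝ) lam.B₁ c₁ (fun j : IdxB8SubB θ => zdCubP θ.𝔸 θ.L ρ₀ j.1.1)) ∧
      (B8.Thm2Printed (fun j : IdxB8SubB θ => (zdGF3P θ.𝔸 θ.L lam.β lam.len j.1.1).toGFData) ∧
        B8.Prop3Printed θ.D (θ.L : ℝ) lam.C₂ lam.inp lam.B₀β (fun j : IdxB8SubB θ => (zdGF3P θ.𝔸 θ.L lam.β lam.len j.1.1).toGFData2) ∧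
        B8.Thm4Printed lam.B₁' (fun j : IdxB8SubB θ => (zdGF3P θ.𝔸 θ.L lam.β lam.len j.1.1).toGFData) ∧
        B8SectGH.Prop7PrintedR (fun j : IdxB8SubB θ => famB8OfRecordSubBP θ lam.β lam.len j) (fun j => lam.toAxial j.1) ∧
        B8Thm8Surviving.Thm8SurvivingAt 1 lam.B₁ lam.B₂ (fun j : IdxB8SubB θ => famB8OfRecordSubBP θ lam.β lam.len j)) :=
  b8LeafOfRecordSubBP_iff_classFree_and_P (lam.cutSubBP J lan c₁ ρ₀)

/-- ★ **THE SLOT AT dag-n05-d's CUT IMPLIES THE SLOT AT THE PRINT-CLASS CUT, AT EVERY `ρ₀`** — nothing the knits of record conclude (D9b p596490, D9c) is lost by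
re-keying Proposition 6's members on print's class: the `p6` conjunct passes FULL ⇒ CUT (k0-s2-w2's `prop6Printed_zdCubP_of_zdCub` at `f := (·.1.1)`), the other
eight conjuncts are IDENTICAL.  Never conversely (print's class is strictly smaller for `ρ₀ > 1`).
[cite: Balaban1985RegularSpaces, Prop. 6 p.99, p.98 (bookkeeping)] -/
theorem b8LeafOfRecordSubBP_cutSubBP_of_cutSubB (lam : ResidB8 θ) (J : Type) (lan : J → B8.LandauData) (c₁ : ℝ) (ρ₀ : ℕ)
    (h : B8LeafOfRecordSubBP θ (lam.cutSubB J lan c₁)) : B8LeafOfRecordSubBP θ (lam.cutSubBP J lan c₁ ρ₀) := by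
  obtain ⟨⟨h1, h5e, h5u, h6⟩, hP⟩ := (b8LeafOfRecordSubBP_cutSubB_iff_classFree_and_P lam J lan c₁).1 h
  exact (b8LeafOfRecordSubBP_cutSubBP_iff_classFree_and_P lam J lan c₁ ρ₀).2
    ⟨⟨h1, h5e, h5u, prop6Printed_zdCubP_of_zdCub (fun j : IdxB8SubB θ => j.1.1) ρ₀ h6⟩, hP⟩

/-- ★ **THE SLOT AT dag-n05-d's CUT WITH THRESHOLD `c₁`, PLUS PROPOSITION 6 ON PRINT'S CLASS WITH THRESHOLD `c₁′`, GIVE THE SLOT AT THE PRINT-CLASS CUT WITH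
THRESHOLD `c₁′`** — the transfer WITH THRESHOLD CHANGE (k0-s2-w2 g3's device (iii), OFFER-C′): the eight non-Prop-6 conjuncts of `B8LeafOfRecordSubBP θ (λ.cutSubB J lan c₁)`
do not read the threshold, so they move verbatim; `p6` is the supplied print-class sentence.  With `c₁ := 0` the source slot needs NO genuine Proposition-6 input
(`prop6Printed_cubB8OfRecord_subB_of_nonpos` below), so a knit of record BY NAME at threshold `0` plus p596570 gives the print-class slot at the GENUINE threshold.
[cite: Balaban1985RegularSpaces, Prop. 6 p.99, Thm 2 p.83 («There exist constants B₁, B₂(β₀), c₁») (bookkeeping)] -/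
theorem b8LeafOfRecordSubBP_cutSubBP_of_cutSubB' (lam : ResidB8 θ) (J : Type) (lan : J → B8.LandauData) {c₁ c₁' : ℝ} (ρ₀ : ℕ)
    (h : B8LeafOfRecordSubBP θ (lam.cutSubB J lan c₁))
    (p6 : B8.Prop6Printed θ.D (θ.L : ℝ) lam.B₁ c₁' (fun j : IdxB8SubB θ => zdCubP θ.𝔸 θ.L ρ₀ j.1.1)) :
    B8LeafOfRecordSubBP θ (lam.cutSubBP J lan c₁' ρ₀) := by
  obtain ⟨⟨h1, h5e, h5u, -⟩, hP⟩ := (b8LeafOfRecordSubBP_cutSubB_iff_classFree_and_P lam J lan c₁).1 h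
  exact (b8LeafOfRecordSubBP_cutSubBP_iff_classFree_and_P lam J lan c₁' ρ₀).2 ⟨⟨h1, h5e, h5u, p6⟩, hP⟩

end ReadingP

/-! ## §1b  LOCATED HAZARD (k0-s2-w2 g3, OFFER-C §3): the typed Proposition-6 conjunct is JUNK-SATISFIABLE at a non-positive threshold -/

section ThresholdZero

variable {d : ℕ} {𝔸 : Type} [CStarAlgebra 𝔸] {L : ℕ}

/-- **`B8.Prop6Printed` AT A NON-POSITIVE THRESHOLD IS VACUOUSLY TRUE ON EVERY `zdCub` FAMILY** (`d ≥ 1`): every cube has side `M > 11d ≥ 0` and the smallness parameter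
is `α₀ > 0`, so the antecedent «7dL²Mα₀ ≤ c₁» never fires when `c₁ ≤ 0` (`L ≥ 1`; at `L = 0` the left side is `0 ≤ c₁`, excluded by `c₁ < 0` only — we assume `1 ≤ L`).
LOCATED HAZARD (k0-s2-w2 g3): the typed slot never forces `c₁ > 0`; print's `c₁` is a POSITIVE constant (Thm 2 p. 83) and only a consumer reading `0 < c₁` makes the
conjunct genuine — p596570's witnesses carry `0 < c₁⋆`.  [cite: Balaban1985RegularSpaces, Prop. 6 p.99 («let 7dL²Mα₀ ≤ c₁»), Thm 2 p.83 (bookkeeping ∕ vacuity certificate)] -/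
theorem prop6Printed_zdCub_of_nonpos (hd : 1 ≤ d) (hL : 1 ≤ L) {ι : Type} (f : ι → ZdIdx d L) {B₁ c₁ : ℝ} (hc : c₁ ≤ 0) :
    B8.Prop6Printed d (L : ℝ) B₁ c₁ (fun j => Node00.zdCub 𝔸 L (f j)) := by
  rw [Node00.prop6Printed_zdCub_iff]
  intro j α₀ hα U₀ _ c hs
  exfalso
  have hd' : (0 : ℝ) < d := by exact_mod_cast hd
  have hL' : (0 : ℝ) < L := by exact_mod_cast hL
  have hM : (0 : ℝ) < c.M := by
    have := c.big
    exact_mod_cast (show 0 < c.M by omega)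
  have hpos : 0 < 7 * (d : ℝ) * (L : ℝ) ^ 2 * c.M * α₀ :=
    mul_pos (mul_pos (mul_pos (mul_pos (by norm_num) hd') (pow_pos hL' 2)) hM) hα
  linarith

/-- **The same on every print-class family `zdCubP … ρ₀`** (FULL ⇒ CUT). [cite: Balaban1985RegularSpaces, Prop. 6 p.99 (vacuity certificate)] -/
theorem prop6Printed_zdCubP_of_nonpos (hd : 1 ≤ d) (hL : 1 ≤ L) {ι : Type} (f : ι → ZdIdx d L) (ρ₀ : ℕ) {B₁ c₁ : ℝ} (hc : c₁ ≤ 0) :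
    B8.Prop6Printed d (L : ℝ) B₁ c₁ (fun j => zdCubP 𝔸 L ρ₀ (f j)) :=
  prop6Printed_zdCubP_of_zdCub f ρ₀ (prop6Printed_zdCub_of_nonpos hd hL f hc)

/-- **THE `p6` BINDER OF THE KNITS OF RECORD AT THRESHOLD `c₁ ≤ 0` IS FREE** (k0-s2-w2 g3's (i)): `B8.Prop6Printed θ.D θ.L B₁ c₁ (fun j : IdxB8SubB θ => cubB8OfRecord θ j.1)`
holds for every `B₁` once `c₁ ≤ 0` (`θ.D ≥ 1`; `θ.L ≥ 2` from `θ.hL`) — so dag-n05-d's D9b ∕ D9c BY NAME at `c₁ := 0` conclude `B8LeafOfRecordSubBP θ (λ.cutSubB J lan 0)` with NO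
genuine Proposition-6 input, and `b8LeafOfRecordSubBP_cutSubBP_of_cutSubB'` carries that to the print-class cut at p596570's genuine threshold `c₁⋆ > 0`.
[cite: Balaban1985RegularSpaces, Prop. 6 p.99 (vacuity certificate ∕ bookkeeping)] -/
theorem prop6Printed_cubB8OfRecord_subB_of_nonpos {θ : Stage3Params} (hD : 1 ≤ θ.D) {B₁ c₁ : ℝ} (hc : c₁ ≤ 0) :
    B8.Prop6Printed θ.D (θ.L : ℝ) B₁ c₁ (fun j : IdxB8SubB θ => cubB8OfRecord θ j.1) :=
  prop6Printed_zdCub_of_nonpos (𝔸 := θ.𝔸) hD (le_trans (by norm_num) θ.two_le_L) (fun j : IdxB8SubB θ => j.1.1) hc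

end ThresholdZero

/-! ## §2  ★★★ The constructor of the P-slot at the print-class cut layer WITH PROPOSITION 6 SUPPLIED (eight binders) -/

section Fields8

variable (θ : Stage3Params)

/-- ★★★ **CONSTRUCTOR OF THE P-SLOT AT THE PRINT-CLASS CUT LAYER FROM EIGHT CONJUNCTS — PROPOSITION 6 SUPPLIED** (`θ.D ≥ 2`, `θ.L ≥ 5`; `θ.L` odd by `θ.hL`).
There are a big-block size `ρ₀ ≥ 1` (print's `R₁M₁`) and constants `B₁⋆ > 0`, `c₁⋆ > 0` — functions of `θ.D, θ.L` — such that for EVERY residual layer `λ` with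
`B₁⋆ ≤ λ.B₁`, every Prop.-5 carrier family `lan : J → LandauData` and every threshold `c₁ ≤ c₁⋆`: Lemma 1, Thm 2 ∕ Prop 3 ∕ Thm 4 at the P-members, Prop. 5 ∃ ∕ ! at
`lan`, Prop. 7 and Thm 8 surviving at the P-members (n05-w1's `b8LeafOfRecordSubBP_of_fields` binders `l1 t2 p3 t4 p5e p5u p7 t8` at this layer, letter for letter)
give `B8LeafOfRecordSubBP θ (λ.cutSubBP J lan c₁ ρ₀)`.  The ninth binder `p6 : B8.Prop6Printed θ.D θ.L λ.B₁ c₁ (fun j => zdCubP θ.𝔸 θ.L ρ₀ j.1.1)` is SUPPLIED by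
`B8Prop6PrintedZdCubPGamma.p6_residB8_of_zdCubP` ([B8] Proposition 6 (1.135)–(1.138) as printed on print's p. 98 class, unconditional: dag-n05-c's transplant T4 ∘ the
flat line γ Fγ1–Fγ11 ∘ the general junction).
[cite: Balaban1985RegularSpaces, Prop. 6 (1.135)–(1.138) p.99, p.98; Lemma 1 p.79, Thm 2 p.83, Prop. 3 p.87, Thm 4 p.88, Prop. 5 p.94, Prop. 7 p.100, Thm 8 (1.146) p.101 (the eight displayed binders)] -/
theorem b8LeafOfRecordSubBP_cutSubBP_of_fields8 (hD : 2 ≤ θ.D) (hL5 : 5 ≤ θ.L) :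
    ∃ ρ₀ : ℕ, ∃ B₁ c₁' : ℝ, 1 ≤ ρ₀ ∧ 0 < B₁ ∧ 0 < c₁' ∧
      ∀ (lam : ResidB8 θ) (J : Type) (lan : J → B8.LandauData) (c₁ : ℝ), B₁ ≤ lam.B₁ → c₁ ≤ c₁' →
        B8.Lemma1Printed θ.D (blockPairNA θ.D θ.L θ.𝔸) →
        B8.Thm2Printed (fun j : IdxB8SubB θ => (zdGF3P θ.𝔸 θ.L lam.β lam.len j.1.1).toGFData) →
        B8.Prop3Printed θ.D (θ.L : ℝ) lam.C₂ lam.inp lam.B₀β (fun j : IdxB8SubB θ => (zdGF3P θ.𝔸 θ.L lam.β lam.len j.1.1).toGFData2) →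
        B8.Thm4Printed lam.B₁' (fun j : IdxB8SubB θ => (zdGF3P θ.𝔸 θ.L lam.β lam.len j.1.1).toGFData) →
        B8.Prop5Exists lam.inp.B₀' lam.B₁ lan → B8.Prop5Unique lan →
        B8SectGH.Prop7PrintedR (fun j : IdxB8SubB θ => famB8OfRecordSubBP θ lam.β lam.len j) (fun j => lam.toAxial j.1) →
        B8Thm8Surviving.Thm8SurvivingAt 1 lam.B₁ lam.B₂ (fun j : IdxB8SubB θ => famB8OfRecordSubBP θ lam.β lam.len j) →
        B8LeafOfRecordSubBP θ (lam.cutSubBP J lan c₁ ρ₀) := by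
  obtain ⟨ρ₀, B₁, c₁', hρ₀, -, hB₁, hc₁', P6⟩ := p6_residB8_of_zdCubP θ hD hL5 (t := 1) le_rfl
  refine ⟨ρ₀, B₁, c₁', hρ₀, hB₁, hc₁', fun lam J lan c₁ hB hc l1 t2 p3 t4 p5e p5u p7 t8 => ?_⟩
  have p6 : B8.Prop6Printed θ.D (θ.L : ℝ) lam.B₁ c₁ (fun j : IdxB8SubB θ => zdCubP θ.𝔸 θ.L ρ₀ j.1.1) :=
    P6 (lam.cutSubBP J lan c₁ ρ₀) (fun j : IdxB8SubB θ => j.1.1) rfl hB hc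
  exact (b8LeafOfRecordSubBP_cutSubBP_iff_classFree_and_P lam J lan c₁ ρ₀).2 ⟨⟨l1, p5e, p5u, p6⟩, ⟨t2, p3, t4, p7, t8⟩⟩

/-- **… WITH THE BIG BLOCK A MULTIPLE OF ANY GIVEN `t ≥ 1`** (for knits whose other members want `t ∣ ρ₀`, e.g. `t = L^j`): the same eight-binder constructor.
[cite: Balaban1985RegularSpaces, Prop. 6 p.99, p.98 («M is a multiple of R₁M₁»)] -/
theorem b8LeafOfRecordSubBP_cutSubBP_of_fields8_dvd (hD : 2 ≤ θ.D) (hL5 : 5 ≤ θ.L) {t : ℕ} (ht : 1 ≤ t) :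
    ∃ ρ₀ : ℕ, ∃ B₁ c₁' : ℝ, 1 ≤ ρ₀ ∧ t ∣ ρ₀ ∧ 0 < B₁ ∧ 0 < c₁' ∧
      ∀ (lam : ResidB8 θ) (J : Type) (lan : J → B8.LandauData) (c₁ : ℝ), B₁ ≤ lam.B₁ → c₁ ≤ c₁' →
        B8.Lemma1Printed θ.D (blockPairNA θ.D θ.L θ.𝔸) →
        B8.Thm2Printed (fun j : IdxB8SubB θ => (zdGF3P θ.𝔸 θ.L lam.β lam.len j.1.1).toGFData) →
        B8.Prop3Printed θ.D (θ.L : ℝ) lam.C₂ lam.inp lam.B₀β (fun j : IdxB8SubB θ => (zdGF3P θ.𝔸 θ.L lam.β lam.len j.1.1).toGFData2) →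
        B8.Thm4Printed lam.B₁' (fun j : IdxB8SubB θ => (zdGF3P θ.𝔸 θ.L lam.β lam.len j.1.1).toGFData) →
        B8.Prop5Exists lam.inp.B₀' lam.B₁ lan → B8.Prop5Unique lan →
        B8SectGH.Prop7PrintedR (fun j : IdxB8SubB θ => famB8OfRecordSubBP θ lam.β lam.len j) (fun j => lam.toAxial j.1) →
        B8Thm8Surviving.Thm8SurvivingAt 1 lam.B₁ lam.B₂ (fun j : IdxB8SubB θ => famB8OfRecordSubBP θ lam.β lam.len j) →
        B8LeafOfRecordSubBP θ (lam.cutSubBP J lan c₁ ρ₀) := by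
  obtain ⟨ρ₀, B₁, c₁', hρ₀, hdvd, hB₁, hc₁', P6⟩ := p6_residB8_of_zdCubP θ hD hL5 ht
  refine ⟨ρ₀, B₁, c₁', hρ₀, hdvd, hB₁, hc₁', fun lam J lan c₁ hB hc l1 t2 p3 t4 p5e p5u p7 t8 => ?_⟩
  have p6 : B8.Prop6Printed θ.D (θ.L : ℝ) lam.B₁ c₁ (fun j : IdxB8SubB θ => zdCubP θ.𝔸 θ.L ρ₀ j.1.1) :=
    P6 (lam.cutSubBP J lan c₁ ρ₀) (fun j : IdxB8SubB θ => j.1.1) rfl hB hc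
  exact (b8LeafOfRecordSubBP_cutSubBP_iff_classFree_and_P lam J lan c₁ ρ₀).2 ⟨⟨l1, p5e, p5u, p6⟩, ⟨t2, p3, t4, p7, t8⟩⟩

/-- ★★★ **THE BY-NAME ROAD FOR THE KNITS OF RECORD** (k0-s2-w2 g3's threshold-zero device, `θ.D ≥ 2`, `θ.L ≥ 5`): there are `ρ₀ ≥ 1`, `B₁⋆ > 0`, `c₁⋆ > 0` such that
for every residual layer `λ` with `B₁⋆ ≤ λ.B₁`, every `J, lan` and every source threshold `c₁`, the P-slot at dag-n05-d's cut `B8LeafOfRecordSubBP θ (λ.cutSubB J lan c₁)`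
— which D9b ∕ D9c conclude BY NAME, and at `c₁ := 0` with their `p6` binder FREE (`prop6Printed_cubB8OfRecord_subB_of_nonpos`) — gives the P-slot at the print-class cut
`B8LeafOfRecordSubBP θ (λ.cutSubBP J lan c₁⋆ ρ₀)` AT THE GENUINE THRESHOLD `c₁⋆ > 0`, Proposition 6 SUPPLIED by p596570.  No knit re-run, no unbundling.
[cite: Balaban1985RegularSpaces, Prop. 6 (1.135)–(1.138) p.99, p.98, Thm 2 p.83 («There exist constants B₁, B₂(β₀), c₁»)] -/
theorem b8LeafOfRecordSubBP_cutSubBP_of_cutSubB_any (hD : 2 ≤ θ.D) (hL5 : 5 ≤ θ.L) :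
    ∃ ρ₀ : ℕ, ∃ B₁ c₁' : ℝ, 1 ≤ ρ₀ ∧ 0 < B₁ ∧ 0 < c₁' ∧
      ∀ (lam : ResidB8 θ) (J : Type) (lan : J → B8.LandauData) (c₁ : ℝ), B₁ ≤ lam.B₁ →
        B8LeafOfRecordSubBP θ (lam.cutSubB J lan c₁) → B8LeafOfRecordSubBP θ (lam.cutSubBP J lan c₁' ρ₀) := by
  obtain ⟨ρ₀, B₁, c₁', hρ₀, -, hB₁, hc₁', P6⟩ := p6_residB8_of_zdCubP θ hD hL5 (t := 1) le_rfl
  refine ⟨ρ₀, B₁, c₁', hρ₀, hB₁, hc₁', fun lam J lan c₁ hB h => ?_⟩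
  exact b8LeafOfRecordSubBP_cutSubBP_of_cutSubB' lam J lan ρ₀ h
    (P6 (lam.cutSubBP J lan c₁' ρ₀) (fun j : IdxB8SubB θ => j.1.1) rfl hB le_rfl)

end Fields8

/-! ## §3  Non-vacuity of the layer's Proposition-6 index -/

/-- Non-vacuity of the print-class cut layer's Proposition-6 index: the four-law sub-index is inhabited (n05-c's `B8IdxB8LawsB.nonempty_idxB8SubB`: genuine
`Ω_j = ℤᵈ` members at every depth), so Proposition 6's conjunct does not range over an empty index.
[cite: Balaban1985RegularSpaces, p.77 («we admit Ω_j = T_η»), Prop. 6 p.99 (bookkeeping)] -/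
theorem nonempty_cutSubBP_I8d {θ : Stage3Params} (lam : ResidB8 θ) (J : Type) (lan : J → B8.LandauData) (c₁ : ℝ) (ρ₀ : ℕ) :
    Nonempty (lam.cutSubBP J lan c₁ ρ₀).I8d :=
  B8IdxB8LawsB.nonempty_idxB8SubB θ

/-- **A6 ∕ NON-VACUITY OF PROPOSITION 6's CONJUNCT AT THE PRINT-CLASS CUT**: at EVERY big-block size `ρ₀ ≥ 1` some member of the layer's Proposition-6 index carries a
PRINT cube (`θ.D ≥ 1`; the all-`T` law member of depth 1 at `η = L⁻¹` — n05-a's `exists_member_univ` + n05-c's `idxB8LawsB_of_member_univ` — and k0-s2-w2's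
`CubeB8.IsPrint.cubeOfUniv` in it), so `B8.Prop6Printed θ.D θ.L B₁ c₁ (λ.cutSubBP J lan c₁ ρ₀).cub` quantifies over an inhabited cube type at some member (and its inner
antecedents are met at `U₀ = 1`, `B8Prop6OfThm4.one_inAk`): the conjunct is NOT vacuous family-wide.
[cite: Balaban1985RegularSpaces, p.98 («To prove condition (3.35) it is enough to take one such cube»), p.77 («we admit Ω_j = T_η») (vacuity standard)] -/
theorem exists_member_printCube_cutSubBP {θ : Stage3Params} (hD : 1 ≤ θ.D) (lam : ResidB8 θ) (J : Type) (lan : J → B8.LandauData) (c₁ : ℝ)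
    {ρ₀ : ℕ} (hρ₀ : 1 ≤ ρ₀) :
    ∃ j : (lam.cutSubBP J lan c₁ ρ₀).I8d, Nonempty ((lam.cutSubBP J lan c₁ ρ₀).cub j).Cube := by
  have hL : 1 ≤ θ.L := le_trans (by norm_num) θ.two_le_L
  have hη : (0 : ℝ) < ((θ.L : ℝ)⁻¹) ^ 1 := pow_pos (inv_pos.mpr (by exact_mod_cast (show 0 < θ.L by omega))) 1
  obtain ⟨i, h0, hik, hiη, hΩ, hΛ, hΛb⟩ := B8LeafModelZd3NonVacuity.exists_member_univ (d := θ.D) hL (le_refl 1) hη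
  refine ⟨⟨⟨i, h0⟩, B8IdxB8LawsB.idxB8LawsB_of_member_univ hL (by rw [hiη, hik]) hΩ hΛ hΛb⟩, ?_⟩
  exact Node00.exists_isPrint_of_univ hD hL hρ₀ (by rw [hik]) (hΩ _) (hΩ _)

#print axioms b8LeafOfRecordSubBP_cutSubBP_of_fields8

end Literature.MathematicalPhysics.QuantumFieldTheory.Balaban1983to89.B8LeafOfRecordSubBPCutPFields8

end
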